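import Literature.AnabelianGeometry.AbsoluteAnabelian.FreeProcyclicHOneEval
import HarnessLib

/-!
# `H¹(G, M) ⥲ M/(γ − 1)M` for a free procyclic group and a TORSION discrete module

abc-iut cell, layer L4.  PROOF file (no definition, no named fact).  `FreeProcyclicHOneEval.lean`
proves that the evaluation map `evalMod τ γ : H¹(G, B) →+ B ⧸ (γ − 1)B`, `[z] ↦ z(γ)`, is bijective for
`G ≅ Ẑ` topologically generated by `γ` (dense `γ^ℤ`, an open subgroup of every positive index — the
cell's `FundamentalExtension.IsFreeProcyclic`) and `B` FINITE.  Here the same for every TORSION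
discrete `G`-module `M` (e.g. `μ_∞`, `ℚ/ℤ(1)`, torsion points), by reduction to the finite
`G`-stable submodule generated by a torsion element (`finite_genSubmodule_of_isTorsion`, trunk
`FiniteCoefficientsTorsion.lean`):

* `exists_openNormal_rightInvariant` — a continuous crossed homomorphism on a profinite group with
  values in a discrete module is right-invariant under some open normal subgroup (no finiteness);
* `evalMod_injective_of_dense_zpowers` (any discrete `M`), `evalMod_surjective_of_isTorsion`,
  **`evalMod_bijective_of_isTorsion`** — "`H¹(Ẑ, M) = M/(F − 1)M`" for torsion `M`
  (Serre, *Local Fields* XIII §1 Prop. 1 / Remark; Milne, *ADT* I §2 Lemma 2.9);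
  `IsFreeProcyclic.evalMod_bijective_of_isTorsion`.

HONEST FRAMING: classical; nothing here bears on [IUTchIII] Cor. 3.12 or takes a side.
-/

noncomputable section

open CategoryTheory Function

universe u

namespace Literature.AnabelianGeometry.AbsoluteAnabelian

open Literature.NumberTheory.GaloisRepresentations
open _root_.TopRep _root_.ContRepresentation _root_.ContinuousCohomology _root_.Topology _root_.Filter

variable {G : Type u} [Group G] [TopologicalSpace G] [IsTopologicalGroup G] [CompactSpace G]
  [TotallyDisconnectedSpace G]
variable {M : Type u} [AddCommGroup M] [TopologicalSpace M] [DiscreteTopology M]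

/-- **A continuous crossed homomorphism on a profinite group with values in a discrete module is
right-invariant under an open normal subgroup** (uniform local constancy; no finiteness of the module).
[cite: SerreLocalFields1979, XIII §1 Prop. 1] -/
theorem exists_openNormal_rightInvariant (τ : ContinuousRep G ℤ M) (w : contOneCocycles τ.toTopRep) :
    ∃ H : Subgroup G, H.Normal ∧ IsOpen (H : Set G) ∧ ∀ σ, ∀ h ∈ H, w.1 (σ * h) = w.1 σ := by
  obtain ⟨V, hV, hVw⟩ := exists_nhds_one_forall_eq' (X := G) (P := G)
    (fun a v => w.1 (a * v)) (w.1.continuous.comp continuous_mul)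
  have h1 : (1 : G) ∈ interior V := mem_interior_iff_mem_nhds.2 hV
  obtain ⟨W, hW⟩ := ProfiniteGrp.exist_openNormalSubgroup_sub_open_nhds_of_one isOpen_interior h1
  refine ⟨W, inferInstance, W.isOpen', fun σ h hh => ?_⟩
  have e := hVw σ h (interior_subset (hW hh))
  change w.1 (σ * h) = w.1 (σ * 1) at e
  rwa [mul_one] at e

/-- **`[z] ↦ z(γ)` is injective on `H¹(G, M)`** for `G` profinite with dense `γ^ℤ` and ANY discrete
`G`-module `M`: a cocycle with `z(γ) = (γ − 1)b` differs from the coboundary of `b` by a cocycle inflated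
from a finite cyclic quotient vanishing at the generator, hence zero.
[cite: SerreLocalFields1979, XIII §1 Prop. 1] -/
theorem evalMod_injective_of_dense_zpowers {γ : G} (hγ : Dense (Subgroup.zpowers γ : Set G))
    (τ : ContinuousRep G ℤ M) : Injective (evalMod τ γ) := by
  intro c d hcd
  obtain ⟨z, rfl⟩ := oneCocycleClass_surjective _ c
  obtain ⟨z', rfl⟩ := oneCocycleClass_surjective _ d
  rw [evalMod_oneCocycleClass, evalMod_oneCocycleClass, QuotientAddGroup.eq, mem_subOneRange_iff] at hcd
  obtain ⟨b₁, hb₁⟩ := hcd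
  set w : contOneCocycles τ.toTopRep := z' - z - coboundaryCocycle τ b₁ with hwdef
  obtain ⟨H, hHn, hHo, hHw⟩ := exists_openNormal_rightInvariant τ w
  haveI := hHn
  have hw0 : w = 0 := by
    refine contOneCocycles.eq_zero_of_apply_eq_zero γ H
      (fun r => exists_pow_eq_mk_of_dense_zpowers hγ H hHo r) w hHw ?_
    change z'.1 γ - z.1 γ - (τ γ b₁ - b₁) = 0
    rw [hb₁]; abel
  have : oneCocycleClass _ z' - oneCocycleClass _ z = 0 := by
    rw [← oneCocycleClass_sub, show z' - z = w + coboundaryCocycle τ b₁ by rw [hwdef]; abel, hw0,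
      zero_add, oneCocycleClass_coboundaryCocycle]
  exact (sub_eq_zero.1 this).symm

/-- **`[z] ↦ z(γ)` maps `H¹(G, M)` ONTO `M/(γ − 1)M` for `G ≅ Ẑ` generated by `γ` and `M` a TORSION
discrete module**: a torsion element `b₀` generates a FINITE `G`-stable submodule `B`
(`finite_genSubmodule_of_isTorsion`), over which `FreeProcyclicHOneEval` supplies a cocycle with value
`b₀` at `γ`. [cite: SerreLocalFields1979, XIII §1 Prop. 1] -/
theorem evalMod_surjective_of_isTorsion {γ : G} (hγ : Dense (Subgroup.zpowers γ : Set G))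
    (hidx : ∀ n : ℕ, 0 < n → ∃ H : Subgroup G, IsOpen (H : Set G) ∧ H.index = n)
    (hM : AddMonoid.IsTorsion M) (τ : ContinuousRep G ℤ M) : Surjective (evalMod τ γ) := by
  intro y
  obtain ⟨b₀, rfl⟩ := QuotientAddGroup.mk_surjective y
  -- the finite `G`-stable submodule generated by `b₀`
  let B : Submodule ℤ M := genSubmodule τ {b₀}
  have hB : ∀ g, B ≤ B.comap (τ g) := genSubmodule_le_comap τ _
  haveI : Finite B := finite_genSubmodule_of_isTorsion τ hM (Set.finite_singleton b₀)
  have hb₀ : b₀ ∈ B := subset_genSubmodule τ _ (Set.mem_singleton b₀)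
  let τB : ContinuousRep G ℤ B := τ.subrepresentation B hB
  -- a cocycle of `B` with value `b₀` at `γ`
  obtain ⟨cB, hcB⟩ := (evalMod_bijective_of_dense_zpowers hγ hidx τB).2
    (QuotientAddGroup.mk ⟨b₀, hb₀⟩)
  obtain ⟨zB, rfl⟩ := oneCocycleClass_surjective _ cB
  rw [evalMod_oneCocycleClass, QuotientAddGroup.eq, mem_subOneRange_iff] at hcB
  obtain ⟨vB, hvB⟩ := hcB
  -- push it to `M`
  let z : contOneCocycles τ.toTopRep :=
    contOneCocycles.pullback (ContinuousMonoidHom.id G) (resIdHom (subtypeHom τ B hB)) zB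
  refine ⟨oneCocycleClass _ z, ?_⟩
  rw [evalMod_oneCocycleClass, QuotientAddGroup.eq, mem_subOneRange_iff]
  refine ⟨(vB : M), ?_⟩
  have e := congrArg (fun b : B => (b : M)) hvB
  change ((τB γ vB - vB : B) : M) = ((-(zB.1 γ) + ⟨b₀, hb₀⟩ : B) : M) at e
  simp only [Submodule.coe_sub, Submodule.coe_add, Submodule.coe_neg] at e
  exact e

/-- **`H¹(G, M) ⥲ M/(γ − 1)M`, `[z] ↦ z(γ)`, for `G ≅ Ẑ` topologically generated by `γ` and `M` a
torsion discrete `G`-module** ("`H¹(Ẑ, M) = M/(F − 1)M`"). [cite: SerreLocalFields1979, XIII §1 Prop. 1] -/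
theorem evalMod_bijective_of_isTorsion {γ : G} (hγ : Dense (Subgroup.zpowers γ : Set G))
    (hidx : ∀ n : ℕ, 0 < n → ∃ H : Subgroup G, IsOpen (H : Set G) ∧ H.index = n)
    (hM : AddMonoid.IsTorsion M) (τ : ContinuousRep G ℤ M) : Bijective (evalMod τ γ) :=
  ⟨evalMod_injective_of_dense_zpowers hγ τ, evalMod_surjective_of_isTorsion hγ hidx hM τ⟩

/-- **`H¹(G, M) ⥲ M/(γ − 1)M` for a free procyclic profinite group, any topological generator `γ` and
any torsion discrete module `M`.** [cite: SerreLocalFields1979, XIII §1 Prop. 1] -/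
theorem FundamentalExtension.IsFreeProcyclic.evalMod_bijective_of_isTorsion
    (h : FundamentalExtension.IsFreeProcyclic G) {γ : G} (hγ : Dense (Subgroup.zpowers γ : Set G))
    (hM : AddMonoid.IsTorsion M) (τ : ContinuousRep G ℤ M) : Bijective (evalMod τ γ) :=
  Literature.AnabelianGeometry.AbsoluteAnabelian.evalMod_bijective_of_isTorsion hγ
    h.exists_isOpen_index hM τ

end Literature.AnabelianGeometry.AbsoluteAnabelian

end
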